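import Literature.MathematicalPhysics.QuantumFieldTheory.Balaban1983to89.B9RWSumsAllBlocksPairM
import Literature.MathematicalPhysics.QuantumFieldTheory.Balaban1983to89.B9RWSums346SecondDiffGpDir
import Literature.MathematicalPhysics.QuantumFieldTheory.Balaban1983to89.B9RWSums346MixedPairDir
import Literature.MathematicalPhysics.QuantumFieldTheory.Balaban1983to89.B9RWSums344InputPairDir
import Literature.MathematicalPhysics.QuantumFieldTheory.Balaban1983to89.B9RWSums343HolderGpDir

/-!
# `Balaban1983to89.B9RWSumsAllBlocksPairMDir` — Theorem 3.7 at the all-blocks pin (PairM co-readings), G′ side, OVER THE DIRECTION LETTERS (ruling R1′):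
# n06-k's `B9RWSumsAllBlocksPairM.thm37Printed_allPin_completePairM` with `hop ∋ DirSupSq37 ∧ Identities₂`, `HolderV37Dir`, the `…Dir` factor schemas and the
# re-threaded member faces — engine re-thread (A4), file 6

T. Bałaban, *Propagators for lattice gauge theories in a background field*, Commun. Math. Phys. **99** (1985) 389–434
[`Balaban1985BackgroundPropagators`, "B9"], Thm 3.7 (3.87)–(3.90) pp. 408–410, Thm 3.7 ⇒ Thm 3.1 p. 410, (3.42)–(3.47) pp. 397–398, Cor. 3.6 p. 408; T. Bałaban,
*Propagators and renormalization transformations for lattice gauge theories. II*, Commun. Math. Phys. **96** (1984) 223–250 [`Balaban1984PropagatorsII`, "[4]"],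
(2.51)–(2.52) p. 232, Lemma 2.1 (2.60)–(2.61) p. 234.

statement-level skeleton of published theorems with citation tags; proofs where landed; nothing here is a claim about the
Yang–Mills mass gap

WHY THIS FILE (cell `pub-ymgap`, Track A node N06 [B9], rows 18–19; dag-n06-d g10 «re-thread the engine over Identities₂»; seat `pub-ymgap-dag-n06-c` g10).
The record path to row 18 is `thm37Printed_allPin_completePairM → B9RWSumsCompleteGeo9YPairM → B9RWSumsDefinitePinsPairM`; its ONLY contact with the structure
identities (3.88) is the `hop` conjunct `Identities` and the K-letter inside the factor∕probe schemas.  Here the same theorem with those read over def-Y's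
per-direction letters (`Identities₂`, `DirSupSq37`, `KopDir ∕ KoptDir`); the G side (`thm310Printed_allPin_completePairM`) is untouched and stays v1.

HONEST SCOPE.  Bookkeeping over n06-k's landed calculus; every leg, factor, co-reading and (3.88) is a HYPOTHESIS schema; `h37` (the sup-block leaf) is a
hypothesis; nothing of [B9] asserted; COUNT-NEUTRAL; N06 NOT discharged; one finite lattice programme — nothing continuum, nothing about OS positivity or
the mass gap.
-/

namespace Literature.MathematicalPhysics.QuantumFieldTheory.Balaban1983to89.B9RWSumsAllBlocksPairMDir

open Finset B6RandomWalk B6RandomWalkHom B9Thm34Ext B9Thm37Whole B9Cor38Whole B9Thm310Whole B9RWSums343to347Whole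
open B9RWSums346Schur B9RWSums343Holder B9RWSums346Lap B9RWSums344Input B9RWSums346Two B9Thm37GlueCor36
open B9SectCDiffDict B9SectDL2Decay B11SectG B9Thm37AllNorms B9Thm37AllNormsInstances B9Ineq347 B9Ineq347AllEntries
open B9CoRealizesRel B9RWSumsReadsRel B9RWSumsReadsNbr B9RWSums346SecondDiff B9RWSums346SecondDiffGp B9Thm37Sum B9Thm37Glue B9RWSums343HolderGp B9RWSums344InputGp B9RWSums346TwoGp
open B9RWSums346MixedPair B9RWSums344InputFam B9RWSums344InputPair B9RWSumsAllBlocksPairM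
open B9Thm37WholeDir B9Thm37KLetterDir B9RWSums346SecondDiffGpDir B9RWSums346MixedPairDir B9RWSums344InputPairDir B9RWSums343HolderGpDir

noncomputable section

section AllPinsGp

variable {I : Type} {c35 : ℝ} {geo : I → B9.Geometry} {bg : I → B9.Backgrounds}
variable [∀ i, Fintype (geo i).Site] [∀ i, DecidableEq (geo i).Site]

/-- Arithmetic of «for M sufficiently large»: a size s ≦ θ₀M⁻¹ and M ≧ 2N′B₁e^{δ₁ρ}θ₀c₁ give N′B₁e^{δ₁ρ}sc₁ ≦ ½ (twin of the siblings'
private lemma). [folklore] -/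
private theorem small_of_size_pair {N' B₀ ex s θ₀ c M : ℝ} (hN' : 0 ≤ N') (hB : 0 ≤ B₀ * ex) (hc : 0 ≤ c) (hM : 0 < M)
    (hs : s ≤ θ₀ * M⁻¹) (hbig : 2 * N' * (B₀ * ex * θ₀) * c ≤ M) : N' * (B₀ * ex * s) * c ≤ 1 / 2 := by
  have h1 : N' * (B₀ * ex * s) * c ≤ N' * (B₀ * ex * (θ₀ * M⁻¹)) * c :=
    mul_le_mul_of_nonneg_right (mul_le_mul_of_nonneg_left (mul_le_mul_of_nonneg_left hs hB) hN') hc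
  have h2 : N' * (B₀ * ex * (θ₀ * M⁻¹)) * c = (N' * (B₀ * ex * θ₀) * c) / M := by
    rw [div_eq_mul_inv]
    ring
  have h3 : (N' * (B₀ * ex * θ₀) * c) / M ≤ 1 / 2 := by
    rw [div_le_iff₀ hM]
    linarith
  exact h1.trans (h2.le.trans h3)

/-- ★★ **THEOREM 3.7 AT THE ALL-BLOCKS PIN WITH NO DISPLAYED RESIDUAL, (3.43)–(3.46) CO-READINGS ON THE NEIGHBOURHOOD — G′ SIDE OVER THE DIRECTION LETTERS
(ruling R1′).**  `B9RWSumsAllBlocksPairM.thm37Printed_allPin_completePairM` with the structure-(3.88) conjunct of `hop` read as `DirSupSq37 ∧ Identities₂` (def-Y's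
per-direction letters `𝔩 : DirLetters37`), the probe schema `HolderV37Dir` and the factor schemas `FactorsL2Second37Dir ∕ FactorsInputPair37Dir ∕ FactorsL2Mixed37Dir`
(K-letters `KopDir ∕ KoptDir`); the member lines through `holder343_of_local37_dir`, `inputPair3445_family_37_dir`, `blockBd_mixed_family_37_dir`,
`blockBd_second_family3∕5_37_dir`; the final bookkeeping `allIneqs_of_majorants_pairM` BY NAME.  Conclusion, constants and every other hypothesis VERBATIM v1.
p. 409: *"The expansion is convergent in all norms appearing in the inequalities (3.42)–(3.47)"*; p. 410: *"Theorem 3.7 implies that all the inequalities (3.42)–(3.47)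
hold for G′"*.  Nothing of print asserted; every input is a hypothesis; NOT a node discharge.
[cite: Balaban1985BackgroundPropagators, Thm 3.7 (3.88)–(3.90) p.409 + Thm 3.7 ⇒ Thm 3.1 p.410 + (3.42)–(3.47) pp.397–398 + Cor. 3.6 p.408; Balaban1984PropagatorsII, (2.51)–(2.52) p.232 + Lemma 2.1 (2.60)–(2.61) p.234] -/
theorem thm37Printed_allPin_completePairM_dir {X Y ι PX PY Q : I → Type} [∀ i, Fintype (X i)] [∀ i, DecidableEq (X i)]
    [∀ i, Fintype (Y i)] [∀ i, DecidableEq (Y i)] [∀ i, Fintype (ι i)] [∀ i, Fintype (PX i)] [∀ i, DecidableEq (PX i)]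
    [∀ i, Fintype (PY i)] [∀ i, DecidableEq (PY i)] [∀ i, Fintype (Q i)]
    {𝔴 : ∀ i, B9.RWExpansion (geo i) (bg i)} {𝔬 : ∀ i, Ops (geo i) (bg i) (X i) (Y i) (ι i)}
    {R : I → ℝ} {H : I → Prop} {C δ : ℝ}
    (𝔭 : ∀ i, HolderProbes (geo i) (bg i) (X i) (Y i) (PX i) (PY i)) (𝔡 : ∀ i, DirOps37 (𝔬 i) (Q i))
    (𝔩 : ∀ i, DirLetters37 (𝔬 i) (Q i))
    (bHX : ∀ i, ℝ → BlockNorm (toB6 (geo i) (R i) (H i)) (X i → ℝ))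
    (K : ∀ i, B9.KernelFamily (geo i) (bg i)) (ev : ∀ i, (geo i).Loc → X i → ℝ) (evY : ∀ i, (geo i).Loc → Y i → ℝ)
    (Rel : ∀ i, (geo i).Site → (geo i).Site → Prop) [∀ i, DecidableRel (Rel i)] (m : ℕ) (r Cev CL : ℝ) (mN : ℕ)
    {d : ℕ} {α L₀ B₀ δ₀ Mg : ℝ} {Bβ Bε : ℝ → ℝ} {Bεβ : ℝ → ℝ → ℝ}
    (κ : I → Sizes) (SH : ∀ i, ι i → Finset (geo i).Site) (Bl BV : ℝ → ℝ) (d₁ : ℕ)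
    (δ₁ α₁ ρ N N' Cℓ Kc θ₀ B₁ NH a₁ M₁ ML : ℝ)
    (S3 : ∀ i, ι i → Finset (geo i).Site) (N3 B3 θ3 NQ : ℝ)
    (SI : ∀ i, ι i → Finset (geo i).Site) (NI : ℝ) (BI θI : ℝ → ℝ) (BI2 : ℝ → ℝ → ℝ)
    (SM : ∀ i, ι i → Finset (geo i).Site) (NM BM θM : ℝ)
    (h37 : B9.Thm37Printed c35 geo bg (fun i => E37OfOps (𝔴 i) (𝔬 i) (R i) (H i) C δ))
    (hRlen : ∀ i (a a' : (geo i).Site), Rel i a a' → (geo i).len a = (geo i).len a')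
    (hRd₁ : ∀ i (a a' b : (geo i).Site), Rel i a a' → (geo i).dist a b = (geo i).dist a' b)
    (hRd₂ : ∀ i (a b b' : (geo i).Site), Rel i b b' → (geo i).dist a b = (geo i).dist a b')
    (hmult : ∀ i (y' : (geo i).Site), (Finset.univ.filter (fun y'' => Rel i y'' y')).card ≤ m)
    (hnbr : ∀ i (y : (geo i).Site), (nbr (geo i) r y).card ≤ mN) (hCL1 : 1 ≤ CL)
    (hCLcmp : ∀ i (a a' : (geo i).Site), (geo i).dist a a' ≤ r → (geo i).len a ≤ CL * (geo i).len a')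
    (htri : ∀ i (a b c : (geo i).Site), (geo i).dist a c ≤ (geo i).dist a b + (geo i).dist b c) (hCev : 0 ≤ Cev)
    (hco0 : ∀ i U, CoRealizesRel (K i) 0 U (Rel i) (𝔬 i).blk (𝔬 i).blk (ev i) ((𝔬 i).Gp U))
    (hco1 : ∀ i U, CoRealizesRel (K i) 1 U (Rel i) (𝔬 i).blkY (𝔬 i).blk (ev i) ((𝔬 i).D U ∘ₗ (𝔬 i).Gp U))
    (hco2 : ∀ i U, CoRealizesRel (K i) 2 U (Rel i) (𝔬 i).blk (𝔬 i).blkY (evY i) ((𝔬 i).Gp U ∘ₗ (𝔬 i).Dstar U))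
    (hco3 : ∀ i U, CoRealizesRel (K i) 3 U (Rel i) (𝔬 i).blk (𝔬 i).blk (ev i) ((𝔬 i).Lap U ∘ₗ (𝔬 i).Gp U))
    (hgl0 : ∀ i U, GlobReads (K i) 0 U (𝔬 i).blk (𝔬 i).blk (ev i) ((𝔬 i).Gp U))
    (hgl1 : ∀ i U, GlobReads (K i) 1 U (𝔬 i).blkY (𝔬 i).blk (ev i) ((𝔬 i).D U ∘ₗ (𝔬 i).Gp U))
    (hgl2 : ∀ i U, GlobReads (K i) 2 U (𝔬 i).blk (𝔬 i).blkY (evY i) ((𝔬 i).Gp U ∘ₗ (𝔬 i).Dstar U))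
    (hgl3 : ∀ i U, GlobReads (K i) 3 U (𝔬 i).blk (𝔬 i).blk (ev i) ((𝔬 i).Lap U ∘ₗ (𝔬 i).Gp U))
    (hl0 : ∀ i U, L2ReadsNbr (R := R i) (H := H i) (K i) 0 U (Rel i) r Cev (𝔬 i).blk (𝔬 i).blk (ev i) ((𝔬 i).Gp U))
    (hl1 : ∀ i U, L2ReadsNbr (R := R i) (H := H i) (K i) 1 U (Rel i) r Cev (𝔬 i).blkY (𝔬 i).blk (ev i) ((𝔬 i).D U ∘ₗ (𝔬 i).Gp U))
    (hl2 : ∀ i U, L2ReadsNbr (R := R i) (H := H i) (K i) 2 U (Rel i) r Cev (𝔬 i).blk (𝔬 i).blkY (evY i)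
      ((𝔬 i).Gp U ∘ₗ (𝔬 i).Dstar U))
    (hl3 : ∀ i U, L2ReadsNbr (R := R i) (H := H i) (K i) 3 U (Rel i) r Cev ((𝔬 i).blk ∘ Prod.fst) (𝔬 i).blk (ev i)
      (familyOp fun p : Q i × Q i => (𝔡 i).Dd U p.1 ∘ₗ ((𝔬 i).Gp U ∘ₗ (𝔡 i).Dsd U p.2)))
    (hl4 : ∀ i U, L2ReadsNbr (R := R i) (H := H i) (K i) 4 U (Rel i) r Cev ((𝔬 i).blk ∘ Prod.fst) (𝔬 i).blk (ev i)
      (familyOp fun p : Q i × Q i => ((𝔡 i).Dd U p.1 ∘ₗ (𝔡 i).Dd U p.2) ∘ₗ (𝔬 i).Gp U))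
    (hl5 : ∀ i U, L2ReadsNbr (R := R i) (H := H i) (K i) 5 U (Rel i) r Cev ((𝔬 i).blk ∘ Prod.fst) (𝔬 i).blk (ev i)
      (familyOp fun p : Q i × Q i => (𝔬 i).Gp U ∘ₗ ((𝔡 i).Dsd U p.1 ∘ₗ (𝔡 i).Dsd U p.2)))
    (hH1 : ∀ i U, H1ReadsNbr (K i) U (𝔭 i) (Rel i) r (𝔬 i).blk (𝔬 i).blkY (ev i) (evY i) ((𝔬 i).D U ∘ₗ (𝔬 i).Gp U)
      ((𝔬 i).Gp U ∘ₗ (𝔬 i).Dstar U))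
    (hIR : ∀ i U, InputReadsFam (K i) U (bHX i) r ((𝔬 i).blk ∘ Prod.fst) ((𝔭 i).blkPX ∘ Prod.fst)
      (fun β => sliceProbe ((𝔭 i).ΦX U β)) (ev i)
      (familyOp fun p : Q i × Q i => (𝔡 i).Dd U p.1 ∘ₗ ((𝔬 i).Gp U ∘ₗ (𝔡 i).Dsd U p.2)))
    (hsym : ∀ i, M₁ ≤ (geo i).M → ∀ α₀ : ℝ, 0 < α₀ → c35 * (geo i).M * α₀ ≤ a₁ →
      ∀ U : (bg i).Cfg, (bg i).Reg335 c35 α₀ U → IsTransposePair ((𝔬 i).Gp U) ((𝔬 i).Gp U))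
    (htr : ∀ i, M₁ ≤ (geo i).M → ∀ α₀ : ℝ, 0 < α₀ → c35 * (geo i).M * α₀ ≤ a₁ →
      ∀ U : (bg i).Cfg, (bg i).Reg335 c35 α₀ U → IsTransposePair ((𝔬 i).D U ∘ₗ (𝔬 i).Gp U) ((𝔬 i).Gp U ∘ₗ (𝔬 i).Dstar U))
    (hfacts : ∀ i, Mg ≤ (geo i).M → Facts347 (geo i) (R i) (H i) d δ α L₀)
    (hdsymm : ∀ i (a b : (geo i).Site), (geo i).dist a b = (geo i).dist b a)
    (hC : 0 ≤ C) (hCB : (m : ℝ) * C ≤ B₀) (hCL : (mN : ℝ) * m * Cev * CL ^ 2 * Real.exp (r * δ₀) * (C * L₀) ≤ B₀)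
    (hδ₀nn : 0 ≤ δ₀) (hδ₀ : δ₀ ≤ (1 - α) * δ)
    (hδ₀2 : δ₀ ≤ (1 - 2 * α) * δ) (hα : 0 ≤ α * δ) (hα2 : 2 * α * δ ≤ δ) (hCg : C * B6.c1 d δ (1 - α) * L₀ ^ (4 : ℝ) ≤ B₀)
    (hc : 0 < c35) (ha₁ : 0 < a₁) (hα₁ : 0 ≤ α₁) (hα₁2 : α₁ ≤ 1 / 2) (hN' : 0 ≤ N')
    (hB₁ : 0 ≤ B₁) (hNH : 0 ≤ NH) (hM₁ : 0 < M₁) (hδnn : 0 ≤ δ) (hδ5 : δ ≤ (1 - 2 * α₁) * δ₁) (hδ₁ : 0 ≤ δ₁) (hN3 : 0 ≤ N3)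
    (hB3 : 0 ≤ B3) (hθ3 : 0 ≤ θ3) (hNI : 0 ≤ NI) (hNM : 0 ≤ NM) (hBM : 0 ≤ BM) (hθM : 0 ≤ θM)
    (hB35 : (mN : ℝ) * m * Cev * CL ^ 2 * Real.exp (r * δ₀) * (NQ * secondConst d₁ δ₁ α₁ N3 B3 N' θ3 C L₀) ≤ B₀)
    (hB3M : (mN : ℝ) * m * Cev * CL ^ 2 * Real.exp (r * δ₀) * (NQ * mixedConst d₁ δ₁ α₁ NM BM N' θM C L₀) ≤ B₀)
    (hst : ∀ i, StaticOK (𝔬 i) ρ N N' Cℓ (κ i)) (hκ : ∀ i, (κ i).Bounded Kc θ₀ Cℓ (geo i).M)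
    (hcntH : ∀ i (a : (geo i).Site), (∑ q, if a ∈ SH i q then (1 : ℝ) else 0) ≤ NH)
    (hcnt3 : ∀ i (a : (geo i).Site), (∑ q, if a ∈ S3 i q then (1 : ℝ) else 0) ≤ N3)
    (hNQ : ∀ i, (Fintype.card (Q i) : ℝ) ≤ NQ)
    (hcntI : ∀ i (a : (geo i).Site), (∑ q, if a ∈ SI i q then (1 : ℝ) else 0) ≤ NI)
    (hcntM : ∀ i (a : (geo i).Site), (∑ q, if a ∈ SM i q then (1 : ℝ) else 0) ≤ NM)
    (hBl : ∀ β, 0 ≤ β → β < 1 → 0 ≤ Bl β) (hBV : ∀ β, 0 ≤ β → β < 1 → 0 ≤ BV β)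
    (hBI : ∀ ε, 0 < ε → ε ≤ 1 → 0 ≤ BI ε) (hBI2 : ∀ ε β, 0 < ε → ε ≤ 1 → 0 ≤ β → β < 1 → 0 ≤ BI2 ε β)
    (hθI : ∀ ε, 0 < ε → 0 ≤ θI ε)
    (hBβ : ∀ β, 0 ≤ β → β < 1 → (m : ℝ) * CL * Real.exp (r * δ₀) * holderConst d₁ δ₁ α₁ NH N' C (Bl β) (BV β) ≤ Bβ β)
    (hBε : ∀ ε, 0 < ε → ε ≤ 1 → Real.exp (r * δ₀) * inputConst44 d₁ δ₁ α₁ NI N' C L₀ (BI ε) (θI ε) ≤ Bε ε)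
    (hBεβ : ∀ ε β, 0 < ε → ε ≤ 1 → 0 ≤ β → β < 1 →
      CL * Real.exp (r * δ₀) *
        inputConst45 d₁ δ₁ α₁ NI N' L₀ (holderConst d₁ δ₁ α₁ NH N' C (Bl β) (BV β)) (BI2 ε β) (θI (β + ε)) ≤ Bεβ ε β)
    (h261 : ∀ i, ML ≤ (geo i).M → Ineq261 d₁ (toB6 (geo i) (R i) (H i)) δ₁ α₁)
    (hop : ∀ i, M₁ ≤ (geo i).M → ∀ α₀ : ℝ, 0 < α₀ → c35 * (geo i).M * α₀ ≤ a₁ →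
      ∀ U : (bg i).Cfg, (bg i).Reg335 c35 α₀ U →
        Local342 (𝔬 i) (R i) (H i) B₁ δ₁ U ∧ DirSupSq37 (𝔬 i) (𝔡 i) (R i) (H i) U ∧ Identities₂ (𝔬 i) (𝔡 i) (𝔩 i) (R i) (H i) U ∧
          HolderLegs37 (𝔬 i) (𝔭 i) (R i) (H i) (SH i) Bl δ₁ U ∧ HolderV37Dir (𝔬 i) (𝔡 i) (𝔩 i) (𝔭 i) (R i) (H i) BV δ₁ U)
    (hop3 : ∀ i, M₁ ≤ (geo i).M → ∀ α₀ : ℝ, 0 < α₀ → c35 * (geo i).M * α₀ ≤ a₁ →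
      ∀ U : (bg i).Cfg, (bg i).Reg335 c35 α₀ U →
        L2SecondLegs37 (𝔬 i) (𝔡 i) (R i) (H i) (S3 i) B3 δ₁ U ∧ FactorsL2Second37Dir (𝔬 i) (𝔡 i) (𝔩 i) (R i) (H i) θ3 δ₁ U ∧
          DirTranspose37 (𝔬 i) (𝔡 i) U)
    (hopI : ∀ i, M₁ ≤ (geo i).M → ∀ α₀ : ℝ, 0 < α₀ → c35 * (geo i).M * α₀ ≤ a₁ →
      ∀ U : (bg i).Cfg, (bg i).Reg335 c35 α₀ U →
        InputLegsPair37 (𝔬 i) (𝔡 i) (𝔭 i) (R i) (H i) (bHX i) (SI i) BI BI2 δ₁ U ∧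
          FactorsInputPair37Dir (𝔬 i) (𝔡 i) (𝔩 i) (R i) (H i) (bHX i) θI δ₁ U ∧ DirSupHolder37 (𝔬 i) (𝔡 i) (𝔭 i) (R i) (H i) U)
    (hopM : ∀ i, M₁ ≤ (geo i).M → ∀ α₀ : ℝ, 0 < α₀ → c35 * (geo i).M * α₀ ≤ a₁ →
      ∀ U : (bg i).Cfg, (bg i).Reg335 c35 α₀ U →
        L2MixedLegs37 (𝔬 i) (𝔡 i) (R i) (H i) (SM i) BM δ₁ U ∧ FactorsL2Mixed37Dir (𝔬 i) (𝔡 i) (𝔩 i) (R i) (H i) θM δ₁ U ∧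
          DirSup37 (𝔬 i) (𝔡 i) (R i) (H i) U) :
    B9.Thm37Printed c35 geo bg (fun i => E37AllOfOps (𝔴 i) (𝔬 i) (R i) (H i) C δ (K i) B₀ δ₀ Bβ Bε Bεβ) := by
  have hαδ₁ : 0 ≤ α₁ * δ₁ := mul_nonneg hα₁ hδ₁
  have hrate : (1 - 2 * α) * δ ≤ (1 - α₁) * δ₁ := by nlinarith [hα, hδ5, hαδ₁]
  have hδδ₁ : δ ≤ (1 - α₁) * δ₁ := hδ5.trans (by nlinarith [hαδ₁])
  have hα₁1 : α₁ ≤ 1 := by linarith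
  have hαδ1 : α * δ ≤ δ := by linarith
  have hc1 : 0 ≤ B6.c1 d₁ δ₁ α₁ := c1_nonneg d₁ δ₁ α₁
  have hBe : 0 ≤ B₁ * Real.exp (δ₁ * ρ) := mul_nonneg hB₁ (Real.exp_nonneg _)
  set Mbig : ℝ := 2 * N' * (B₁ * Real.exp (δ₁ * ρ) * θ₀) * B6.c1 d₁ δ₁ α₁ with hMbig
  refine thm37Printed_strengthen h37 (max (max Mg M₁) (max (max ML M₁) Mbig)) (a₁ / c35) (div_pos ha₁ hc)
    fun i hM α₀ hα₀ hMa U hU hconv => ?_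
  have hMg : Mg ≤ (geo i).M := le_trans (le_trans (le_max_left _ _) (le_max_left _ _)) hM
  have hM₁i : M₁ ≤ (geo i).M := le_trans (le_trans (le_max_right _ _) (le_max_left _ _)) hM
  have hMLi : ML ≤ (geo i).M := le_trans (le_trans (le_trans (le_max_left _ _) (le_max_left _ _)) (le_max_right _ _)) hM
  have hMb : Mbig ≤ (geo i).M := le_trans (le_trans (le_max_right _ _) (le_max_right _ _)) hM
  have hMpos : 0 < (geo i).M := lt_of_lt_of_le hM₁ hM₁i
  have ha : c35 * (geo i).M * α₀ ≤ a₁ := by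
    have h1 : (geo i).M * α₀ * c35 ≤ a₁ := (le_div_iff₀ hc).mp hMa
    calc c35 * (geo i).M * α₀ = (geo i).M * α₀ * c35 := by ring
      _ ≤ a₁ := h1
  have hconv' : Conv342 (𝔬 i) (R i) (H i) C δ U := hconv
  obtain ⟨h0, h1, h2, h3⟩ := hconv'
  obtain ⟨hl, hT, hi, hL, hV⟩ := hop i hM₁i α₀ hα₀ ha U hU
  obtain ⟨hL3, hFL3, hDT⟩ := hop3 i hM₁i α₀ hα₀ ha U hU
  obtain ⟨hIL, hFI, hDH⟩ := hopI i hM₁i α₀ hα₀ ha U hU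
  obtain ⟨hLM, hFLM, hDS⟩ := hopM i hM₁i α₀ hα₀ ha U hU
  have hq : N' * (B₁ * Real.exp (δ₁ * ρ) * ((κ i).kP + (κ i).kC)) * B6.c1 d₁ δ₁ α₁ ≤ 1 / 2 :=
    small_of_size_pair hN' hBe hc1 hMpos (hκ i).row (by rw [hMbig] at hMb; exact hMb)
  have hq' : N' * (B₁ * Real.exp (δ₁ * ρ) * ((κ i).kPt + Cℓ * (κ i).kCt)) * B6.c1 d₁ δ₁ α₁ ≤ 1 / 2 :=
    small_of_size_pair hN' hBe hc1 hMpos (hκ i).col (by rw [hMbig] at hMb; exact hMb)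
  have hF := hfacts i hMg
  have hL₀ : 0 ≤ L₀ := le_trans (le_trans zero_le_one hF.one_le_L) hF.L_le
  have hlen : ∀ y : (geo i).Site, 0 < (geo i).len y := (hst i).lenpos
  -- the operator-level majorants of the members (3.43), (3.46) K-indices 4∕5 (pair families), (3.44)∕(3.45), (3.46) K-index 3 (mixed)
  have hH := holder343_of_local37_dir (𝔬 i) (𝔡 i) (𝔩 i) (𝔭 i) (R i) (H i) d₁ δ₁ α₁ ρ B₁ N N' Cℓ NH C δ (κ i) (SH i) Bl BV U hB₁
    hδ₁ hα₁ hα₁1 hN' hNH hC hδnn hδδ₁ (hst i) (hκ i).nonneg (hcntH i) hBl hBV (h261 i hMLi) hq hl hT hi hL hV h2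
  have hH' : ∀ β : ℝ, 0 ≤ β → β < 1 →
      HasMajorantHom (g := toB6 (geo i) (R i) (H i)) (𝔬 i).blk (𝔭 i).blkPY ((𝔭 i).ΦY U β ∘ₗ ((𝔬 i).D U ∘ₗ (𝔬 i).Gp U))
          (fun (a b : (geo i).Site) => holderConst d₁ δ₁ α₁ NH N' C (Bl β) (BV β) * (geo i).len a ^ (1 - β) *
            Real.exp (-(δ * (geo i).dist a b))) ∧
        HasMajorantHom (g := toB6 (geo i) (R i) (H i)) (𝔬 i).blkY (𝔭 i).blkPX ((𝔭 i).ΦX U β ∘ₗ ((𝔬 i).Gp U ∘ₗ (𝔬 i).Dstar U))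
          (fun (a b : (geo i).Site) => holderConst d₁ δ₁ α₁ NH N' C (Bl β) (BV β) * (geo i).len a ^ (1 - β) *
            Real.exp (-(δ * (geo i).dist a b))) := by
    intro β hβ0 hβ1
    have h := hH β hβ0 hβ1
    rw [LinearMap.comp_assoc] at h
    exact h
  have hK2 : 0 ≤ secondConst d₁ δ₁ α₁ N3 B3 N' θ3 C L₀ := secondConst_nonneg hN3 hB3 hN' hθ3 hC hL₀
  have hwk : ∀ a b : (geo i).Site, (Fintype.card (Q i) : ℝ) * secondConst d₁ δ₁ α₁ N3 B3 N' θ3 C L₀ *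
      Real.exp (-((1 - 2 * α) * δ * (geo i).dist a b)) ≤ NQ * secondConst d₁ δ₁ α₁ N3 B3 N' θ3 C L₀ *
      Real.exp (-((1 - 2 * α) * δ * (geo i).dist a b)) := fun a b =>
    mul_le_mul_of_nonneg_right (mul_le_mul_of_nonneg_right (hNQ i) hK2) (Real.exp_nonneg _)
  have hb4f := (blockBd_second_family3_37_dir (𝔬 i) (𝔡 i) (𝔩 i) (R i) (H i) d d₁ δ α L₀ δ₁ α₁ ρ N N' Cℓ N3 B3 θ3 C (κ i) (S3 i) U hN' hN3
    hB3 hθ3 hC hα2 hαδ₁ hrate (hst i) (hcnt3 i) (h261 i hMLi) hF hi hL3 hFL3 hDT h0 (hsym i hM₁i α₀ hα₀ ha U hU)).mono hwk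
  have hb5 := (blockBd_second_family5_37_dir (𝔬 i) (𝔡 i) (𝔩 i) (R i) (H i) d d₁ δ α L₀ δ₁ α₁ ρ N N' Cℓ N3 B3 θ3 C (κ i) (S3 i) U hN' hN3
    hB3 hθ3 hC hα2 hαδ₁ hrate (hst i) (hcnt3 i) (h261 i hMLi) hF hi hL3 hFL3 h0 (hsym i hM₁i α₀ hα₀ ha U hU)).mono hwk
  -- the nonnegativity of the Hölder constant; the mixed family's L² bound and its (3.44)∕(3.45) majorants (sliced probes)
  have hK0 : ∀ β, 0 ≤ β → β < 1 → 0 ≤ holderConst d₁ δ₁ α₁ NH N' C (Bl β) (BV β) := by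
    intro β hβ0 hβ1
    have hb := hBl β hβ0 hβ1
    have hv := hBV β hβ0 hβ1
    unfold holderConst
    positivity
  obtain ⟨h44, h45⟩ := inputPair3445_family_37_dir (𝔬 i) (𝔡 i) (𝔩 i) (𝔭 i) (R i) (H i) (bHX i) d d₁ δ α L₀ δ₁ α₁ ρ N N' Cℓ NI C (κ i)
    (SI i) (fun β => holderConst d₁ δ₁ α₁ NH N' C (Bl β) (BV β)) BI θI BI2 U hδ₁ hα₁ hN' hNI hC hδδ₁ hα hαδ1 (hst i)
    (hcntI i) hK0 hBI hBI2 hθI (h261 i hMLi) hF hi hIL hFI hDS hDH h1 (fun β hβ0 hβ1 => (hH β hβ0 hβ1).1)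
  have hKM : 0 ≤ mixedConst d₁ δ₁ α₁ NM BM N' θM C L₀ := mixedConst_nonneg hNM hBM hN' hθM hC hL₀
  have hwkM : ∀ a b : (geo i).Site, (Fintype.card (Q i) : ℝ) * mixedConst d₁ δ₁ α₁ NM BM N' θM C L₀ *
      Real.exp (-((1 - 2 * α) * δ * (geo i).dist a b)) ≤ NQ * mixedConst d₁ δ₁ α₁ NM BM N' θM C L₀ *
      Real.exp (-((1 - 2 * α) * δ * (geo i).dist a b)) := fun a b =>
    mul_le_mul_of_nonneg_right (mul_le_mul_of_nonneg_right (hNQ i) hKM) (Real.exp_nonneg _)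
  have hb3f := (blockBd_mixed_family_37_dir (𝔬 i) (𝔡 i) (𝔩 i) (R i) (H i) d d₁ δ α L₀ δ₁ α₁ ρ N N' Cℓ NM BM θM C (κ i) (SM i) U hN' hNM
    hBM hθM hC hα2 hαδ₁ hrate (hst i) (hcntM i) (h261 i hMLi) hF hi hLM hFLM hDS hDT h1 h2 (hsym i hM₁i α₀ hα₀ ha U hU)).mono hwkM
  -- the nonnegativity of the operator-level constants
  have hK35 : 0 ≤ NQ * secondConst d₁ δ₁ α₁ N3 B3 N' θ3 C L₀ :=
    mul_nonneg ((Nat.cast_nonneg _).trans (hNQ i)) hK2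
  have hK3M : 0 ≤ NQ * mixedConst d₁ δ₁ α₁ NM BM N' θM C L₀ :=
    mul_nonneg ((Nat.cast_nonneg _).trans (hNQ i)) hKM
  have hK44 : ∀ ε, 0 < ε → ε ≤ 1 → 0 ≤ inputConst44 d₁ δ₁ α₁ NI N' C L₀ (BI ε) (θI ε) := by
    intro ε hε0 hε1
    have hb := hBI ε hε0 hε1
    have ht := hθI ε hε0
    unfold inputConst44
    positivity
  have hK45 : ∀ ε β, 0 < ε → ε ≤ 1 → 0 ≤ β → β < 1 →
      0 ≤ inputConst45 d₁ δ₁ α₁ NI N' L₀ (holderConst d₁ δ₁ α₁ NH N' C (Bl β) (BV β)) (BI2 ε β) (θI (β + ε)) := by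
    intro ε β hε0 hε1 hβ0 hβ1
    have hb := hBI2 ε β hε0 hε1 hβ0 hβ1
    have ht := hθI (β + ε) (by linarith)
    have hh := hK0 β hβ0 hβ1
    unfold inputConst45
    positivity
  exact ⟨⟨h0, h1, h2, h3⟩, allIneqs_of_majorants_pairM (R := R i) (H := H i) (𝔭 i) (bHX i) (𝔬 i).blk (𝔬 i).blkY (ev i)
    (evY i) (Rel i) m r Cev CL mN (hRlen i) (hRd₁ i) (hRd₂ i) (hmult i) (hnbr i) hCL1 (hCLcmp i) (htri i) hCev h0 h1 h2 h3
    hH' hb3f hb4f hb5 h44 h45 (hsym i hM₁i α₀ hα₀ ha U hU) (htr i hM₁i α₀ hα₀ ha U hU)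
    (hco0 i U) (hco1 i U) (hco2 i U) (hco3 i U) (hgl0 i U) (hgl1 i U) (hgl2 i U) (hgl3 i U) (hl0 i U) (hl1 i U) (hl2 i U)
    (hl3 i U) (hl4 i U) (hl5 i U) (hH1 i U) (hIR i U) hF (hdsymm i) (hst i).dnn hlen hC hK35 hK3M hK0 hK44 hK45 hα hδ₀nn hδ₀
    hδ₀2 hCB hCg hCL hB35 hB3M hBβ hBε hBεβ⟩

end AllPinsGp

end

end Literature.MathematicalPhysics.QuantumFieldTheory.Balaban1983to89.B9RWSumsAllBlocksPairMDir
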